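import Literature.NumberTheory.LFunctions.ConreyVRightEdge
import HarnessLib

/-!
# Conrey's `V` on the lines `σ = m + ½`: `‖V − 𝜙(0)‖ ≤ (1/(m − ½) + η)|𝜙(0)|` eventually

Topic `Literature/NumberTheory/LFunctions`. Everything here is PROVED; there are no definitions
and no named facts.

`ConreyVRightEdge.lean` treats the right edge `σ = 5/2` of the zero-detection rectangle of
Levinson's method. The Littlewood rectangle `[a, σ₁] × [T₁, T₂]` for the mollified function `ψV`
(Conrey, J. Number Theory 16 (1983), §4 (4); Titchmarsh §10.28) needs its right edge `σ₁` as far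
to the right as the mollifier requires (`ψ → 1` only as `σ → ∞`), so here we run the same
argument on every half-integer line `σ = m + ½`, `m ≥ 2`, where the true order
`‖χ(m + ½ + it)‖ ≤ 2(2π)^m t^{−m}`
(`Literature.NumberTheory.LFunctions.SiegelIntegral.norm_rsChi_nat_add_half_le`) is available:

* `norm_polyDerivOp_riemannAux_sub_le_halfInteger` — the main term:
  `‖(𝜙(−δ/L)𝓡)(s) − 𝜙(0)‖ ≤ |𝜙(0)|(1/(m−½) + 5·4^{m+½} x₀^{−3/2}) + (2 + 5·4^{m+3/2}) A₁/L`;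
* `norm_rsChi_mul_polyDerivOp_riemannAuxConj_le_halfInteger` — the reflected term:
  `≤ (2(2π)^m/t^m) · A₂ · 6·4^{m+½} (x₀+1)^{m+3/2}`, i.e. `O(x₀^{3/2−m}) → 0` for `m ≥ 2`;
* `conreyV_halfInteger_edge` — **for `𝜙(0) ≠ 0`, `m ≥ 2` and every `η > 0` there are `L₀ ≥ 1`,
  `T₀ > 0` with `‖V(m + ½ + it) − 𝜙(0)‖ ≤ (1/(m − ½) + η)|𝜙(0)|` for `L ≥ L₀`, `t ≥ T₀`.**

## References

* J. B. Conrey, *Zeros of derivatives of Riemann's ξ-function on the critical line*, J. Number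
  Theory 16 (1983), 49–74, §4 (3)–(4). [Conrey1983]
* E. C. Titchmarsh, *The Theory of the Riemann Zeta-Function*, 2nd ed. (1986), §4.16, §10.28.
  [Titchmarsh1986]
-/

noncomputable section

open Complex Polynomial Set Filter Topology Metric MeasureTheory
open scoped Real ComplexConjugate

namespace Literature.NumberTheory.LFunctions

open Literature.Analysis.Complex SiegelIntegral

/-- A point of the circle `|w − (b + it)| = 1` has `b − 1 ≤ Re w ≤ b + 1`, `t − 1 ≤ Im w ≤ t + 1`.
[folklore] -/
theorem re_im_of_mem_sphere_ofReal {b t : ℝ} {w : ℂ} (hw : w ∈ sphere ((b : ℂ) + t * I) 1) :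
    b - 1 ≤ w.re ∧ w.re ≤ b + 1 ∧ t - 1 ≤ w.im ∧ w.im ≤ t + 1 := by
  rw [mem_sphere_iff_norm] at hw
  have hre := Complex.abs_re_le_norm (w - ((b : ℂ) + t * I))
  have him := Complex.abs_im_le_norm (w - ((b : ℂ) + t * I))
  rw [hw] at hre him
  simp only [sub_re, add_re, ofReal_re, mul_re, I_re, mul_zero, ofReal_im, I_im, mul_one,
    sub_self, add_zero, sub_im, add_im, mul_im, zero_add] at hre him
  obtain ⟨h1, h2⟩ := abs_le.1 hre
  obtain ⟨h3, h4⟩ := abs_le.1 him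
  exact ⟨by linarith, by linarith, by linarith, by linarith⟩

/-- `X ≤ √(y/2π)` when `2πX² ≤ y` (`X ≥ 0`). [folklore] -/
theorem le_sqrt_div_two_pi {X y : ℝ} (hX : 0 ≤ X) (hy : 2 * π * X ^ 2 ≤ y) :
    X ≤ Real.sqrt (y / (2 * π)) := by
  have hπ := Real.pi_pos
  have hy0 : 0 ≤ y := le_trans (by positivity) hy
  rw [Real.le_sqrt hX (by positivity), le_div_iff₀ (by positivity)]
  linarith

/-- **On the circle `|w − (m+½+it)| = 1`** (`m ≥ 2`, `t ≥ 2π(4m+6)² + 128π + 1`):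
`‖𝓡(w) − 1‖ ≤ 2 + 5·4^{m+3/2}`. [cite: Titchmarsh1986, §4.16] -/
theorem norm_riemannAux_sub_one_le_of_mem_sphere_halfInteger {m : ℕ} (hm : 2 ≤ m) {t : ℝ}
    (ht : 2 * π * (4 * m + 6) ^ 2 + 128 * π + 1 ≤ t) {w : ℂ}
    (hw : w ∈ sphere ((((m : ℝ) + 1 / 2 : ℝ) : ℂ) + t * I) 1) :
    ‖riemannAux w - 1‖ ≤ 2 + 5 * (4 : ℝ) ^ ((m : ℝ) + 3 / 2) := by
  have hπ := Real.pi_pos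
  have hm' : (2 : ℝ) ≤ m := by exact_mod_cast hm
  obtain ⟨h1, h2, h3, _⟩ := re_im_of_mem_sphere_ofReal hw
  have hsq : 0 ≤ 2 * π * (4 * (m : ℝ) + 6) ^ 2 := by positivity
  have him : 2 * π * (4 * m + 6) ^ 2 ≤ w.im := by nlinarith
  have hX := le_sqrt_div_two_pi (by positivity : (0 : ℝ) ≤ 4 * m + 6) him
  have h := norm_riemannAux_sub_one_le (σ := w.re) (A := (m : ℝ) + 3 / 2) (t := w.im) (by linarith)
    (by linarith) (by nlinarith) (by linarith)
  rw [Complex.re_add_im] at h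
  refine h.trans (add_le_add ?_ ?_)
  · rw [div_le_iff₀ (by linarith)]; linarith
  · have hx : Real.sqrt (w.im / (2 * π)) ^ (-(3 / 2 : ℝ)) ≤ 1 :=
      Real.rpow_le_one_of_one_le_of_nonpos (by linarith) (by norm_num)
    have h0 : 0 ≤ 5 * (4 : ℝ) ^ ((m : ℝ) + 3 / 2) := by positivity
    calc 5 * (4 : ℝ) ^ ((m : ℝ) + 3 / 2) * Real.sqrt (w.im / (2 * π)) ^ (-(3 / 2 : ℝ))
        ≤ 5 * (4 : ℝ) ^ ((m : ℝ) + 3 / 2) * 1 := mul_le_mul_of_nonneg_left hx h0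
      _ = 5 * (4 : ℝ) ^ ((m : ℝ) + 3 / 2) := mul_one _

/-- **The main term on `σ = m + ½`** (`m ≥ 2`, `t ≥ 2π(4m+6)² + 128π + 1`, `L ≥ 1`; `x₀ = √(t/2π)`,
`A₁ = Σ_{k≠0} |𝜙ₖ| k!`):
`‖(𝜙(−δ/L)𝓡)(m+½+it) − 𝜙(0)‖ ≤ |𝜙(0)| (1/(m−½) + 5·4^{m+½} x₀^{−3/2}) + (2 + 5·4^{m+3/2}) A₁/L`.
[cite: Conrey1983, §4 (3)–(4)] -/
theorem norm_polyDerivOp_riemannAux_sub_le_halfInteger (φ : ℝ[X]) {m : ℕ} (hm : 2 ≤ m) {L t : ℝ}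
    (hL : 1 ≤ L) (ht : 2 * π * (4 * m + 6) ^ 2 + 128 * π + 1 ≤ t) :
    ‖polyDerivOp φ (-L⁻¹) riemannAux ((((m : ℝ) + 1 / 2 : ℝ) : ℂ) + t * I) - (φ.coeff 0 : ℂ)‖ ≤
      |φ.coeff 0| * (1 / ((m : ℝ) - 1 / 2) +
          5 * (4 : ℝ) ^ ((m : ℝ) + 1 / 2) * Real.sqrt (t / (2 * π)) ^ (-(3 / 2 : ℝ))) +
        (2 + 5 * (4 : ℝ) ^ ((m : ℝ) + 3 / 2)) *
          (∑ k ∈ φ.support.erase 0, |φ.coeff k| * (k.factorial : ℝ)) / L := by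
  have hπ := Real.pi_pos
  have hm' : (2 : ℝ) ≤ m := by exact_mod_cast hm
  set s : ℂ := (((m : ℝ) + 1 / 2 : ℝ) : ℂ) + t * I with hs
  set A₁ : ℝ := ∑ k ∈ φ.support.erase 0, |φ.coeff k| * (k.factorial : ℝ) with hA₁
  have hA₁0 : 0 ≤ A₁ := Finset.sum_nonneg fun k _ ↦ by positivity
  -- `k = 0`
  have hsq : 0 ≤ 2 * π * (4 * (m : ℝ) + 6) ^ 2 := by positivity
  have hX := le_sqrt_div_two_pi (by positivity : (0 : ℝ) ≤ 4 * m + 6) (y := t) (by linarith)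
  have hR := norm_riemannAux_sub_one_le (σ := (m : ℝ) + 1 / 2) (A := (m : ℝ) + 1 / 2) (t := t)
    (by linarith) le_rfl (by nlinarith) (by linarith)
  have hR' : ‖riemannAux s - 1‖ ≤ 1 / ((m : ℝ) - 1 / 2) +
      5 * (4 : ℝ) ^ ((m : ℝ) + 1 / 2) * Real.sqrt (t / (2 * π)) ^ (-(3 / 2 : ℝ)) := by
    refine hR.trans (le_of_eq ?_)
    congr 2
    ring
  -- `k ≥ 1`
  have hC := norm_polyDerivOp_sub_coeff_zero_mul_le φ (-L⁻¹) differentiable_riemannAux (s := s)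
    one_pos 1 (fun w hw ↦ norm_riemannAux_sub_one_le_of_mem_sphere_halfInteger hm ht hw)
  have hB := sum_erase_coeff_inv_le φ hL
  have hM0 : 0 ≤ 2 + 5 * (4 : ℝ) ^ ((m : ℝ) + 3 / 2) := by positivity
  have hC' : ‖polyDerivOp φ (-L⁻¹) riemannAux s - (φ.coeff 0 : ℂ) * riemannAux s‖ ≤
      (2 + 5 * (4 : ℝ) ^ ((m : ℝ) + 3 / 2)) * A₁ / L := by
    refine hC.trans ?_
    exact (mul_le_mul_of_nonneg_right hB hM0).trans (le_of_eq (by ring))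
  have hsplit : polyDerivOp φ (-L⁻¹) riemannAux s - (φ.coeff 0 : ℂ) =
      (polyDerivOp φ (-L⁻¹) riemannAux s - (φ.coeff 0 : ℂ) * riemannAux s) +
        (φ.coeff 0 : ℂ) * (riemannAux s - 1) := by ring
  rw [hsplit]
  refine (norm_add_le _ _).trans ?_
  rw [norm_mul, Complex.norm_real, Real.norm_eq_abs, add_comm]
  exact add_le_add (mul_le_mul_of_nonneg_left hR' (abs_nonneg _)) hC'

/-- **The reflected term on `σ = m + ½`** (`m ≥ 2`, `t ≥ 2π(4m+6)² + 128π + 1`, `L ≥ 1`;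
`𝜙̃ = 𝜙∘(1−X)`, `A₂ = Σ |𝜙̃ₖ| k!`):
`‖χ(s)(𝜙̃(δ/L)K)(s)‖ ≤ (2(2π)^m/t^m) · A₂ · 6·4^{m+½} (x₀ + 1)^{m+3/2}` at `s = m + ½ + it`.
[cite: Conrey1983, §4 (3)–(4)] -/
theorem norm_rsChi_mul_polyDerivOp_riemannAuxConj_le_halfInteger (φ : ℝ[X]) {m : ℕ} (hm : 2 ≤ m)
    {L t : ℝ} (hL : 1 ≤ L) (ht : 2 * π * (4 * m + 6) ^ 2 + 128 * π + 1 ≤ t) :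
    ‖rsChi ((((m : ℝ) + 1 / 2 : ℝ) : ℂ) + t * I) *
        polyDerivOp (φ.comp (1 - X)) L⁻¹ riemannAuxConj ((((m : ℝ) + 1 / 2 : ℝ) : ℂ) + t * I)‖ ≤
      2 * (2 * π) ^ m / t ^ m *
        (∑ k ∈ (φ.comp (1 - X)).support, |(φ.comp (1 - X)).coeff k| * (k.factorial : ℝ)) *
        (6 * (4 : ℝ) ^ ((m : ℝ) + 1 / 2) * (Real.sqrt (t / (2 * π)) + 1) ^ ((m : ℝ) + 3 / 2)) := by
  have hπ := Real.pi_pos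
  have hπ3 := Real.pi_gt_three
  have hm' : (2 : ℝ) ≤ m := by exact_mod_cast hm
  have hsq : 0 ≤ 2 * π * (4 * (m : ℝ) + 6) ^ 2 := by positivity
  have ht1 : 1 ≤ t := by nlinarith
  set s : ℂ := (((m : ℝ) + 1 / 2 : ℝ) : ℂ) + t * I with hs
  set ψ : ℝ[X] := φ.comp (1 - X) with hψ
  set A₂ : ℝ := ∑ k ∈ ψ.support, |ψ.coeff k| * (k.factorial : ℝ) with hA₂
  have hA₂0 : 0 ≤ A₂ := Finset.sum_nonneg fun k _ ↦ by positivity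
  set x₀ : ℝ := Real.sqrt (t / (2 * π)) with hx₀
  have hx₀0 : 0 ≤ x₀ := Real.sqrt_nonneg _
  set M : ℝ := 6 * (4 : ℝ) ^ ((m : ℝ) + 1 / 2) * (x₀ + 1) ^ ((m : ℝ) + 3 / 2) with hM
  have hχ : ‖rsChi s‖ ≤ 2 * (2 * π) ^ m / t ^ m := norm_rsChi_nat_add_half_le m ht1
  have hK : ∀ w ∈ sphere s 1, ‖riemannAuxConj w‖ ≤ M := by
    intro w hw
    obtain ⟨h1, h2, h3, h4⟩ := re_im_of_mem_sphere_ofReal hw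
    rw [riemannAuxConj, Complex.norm_conj]
    have e : 1 - conj w = ((1 - w.re : ℝ) : ℂ) + w.im * I := by
      apply Complex.ext <;> simp
    rw [e]
    have him : 2 * π * (4 * m + 6) ^ 2 ≤ w.im := by nlinarith
    have hX := le_sqrt_div_two_pi (by positivity : (0 : ℝ) ≤ 4 * m + 6) him
    have h := norm_riemannAux_le_rpow (σ := 1 - w.re) (A := (m : ℝ) + 1 / 2) (t := w.im)
      (abs_le.2 ⟨by linarith, by linarith⟩) (by nlinarith) (by linarith)
    refine h.trans ?_
    have hmono : Real.sqrt (w.im / (2 * π)) ≤ x₀ + 1 := by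
      calc Real.sqrt (w.im / (2 * π)) ≤ Real.sqrt ((t + 1) / (2 * π)) :=
            Real.sqrt_le_sqrt (div_le_div_of_nonneg_right h4 (by positivity))
        _ ≤ x₀ + 1 := sqrt_add_one_div_le (by linarith)
    have h0 : 0 ≤ 6 * (4 : ℝ) ^ ((m : ℝ) + 1 / 2) := by positivity
    rw [hM, show (1 : ℝ) + ((m : ℝ) + 1 / 2) = (m : ℝ) + 3 / 2 by ring]
    exact mul_le_mul_of_nonneg_left
      (Real.rpow_le_rpow (Real.sqrt_nonneg _) hmono (by positivity)) h0
  have hD := norm_polyDerivOp_le ψ L⁻¹ differentiable_riemannAuxConj (s := s) one_pos hK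
  have hB := sum_coeff_inv_le ψ hL
  have hM0 : 0 ≤ M := by positivity
  have hD' : ‖polyDerivOp ψ L⁻¹ riemannAuxConj s‖ ≤ A₂ * M :=
    hD.trans (mul_le_mul_of_nonneg_right hB hM0)
  rw [norm_mul]
  calc ‖rsChi s‖ * ‖polyDerivOp ψ L⁻¹ riemannAuxConj s‖ ≤ 2 * (2 * π) ^ m / t ^ m * (A₂ * M) :=
        mul_le_mul hχ hD' (norm_nonneg _) (by positivity)
    _ = 2 * (2 * π) ^ m / t ^ m * A₂ * M := by ring

/-- **Conrey's `V` on the line `σ = m + ½`** (`m ≥ 2`): for a real polynomial `𝜙` with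
`𝜙(0) ≠ 0` and every `η > 0` there are `L₀ ≥ 1`, `T₀ > 0` such that
`‖V(m + ½ + it) − 𝜙(0)‖ ≤ (1/(m − ½) + η)|𝜙(0)|` for all `L ≥ L₀`, `t ≥ T₀` (`V = conreyV 𝜙 L`;
the constant `1/(m−½) ≥ Σ_{n≥2} n^{−m−½}` is the size of the tail of the Dirichlet series on
that line). [cite: Conrey1983, §4 (3)–(4)] -/
theorem conreyV_halfInteger_edge (φ : ℝ[X]) (hφ : φ.coeff 0 ≠ 0) {m : ℕ} (hm : 2 ≤ m) {η : ℝ}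
    (hη : 0 < η) :
    ∃ L₀ T₀ : ℝ, 1 ≤ L₀ ∧ 0 < T₀ ∧ ∀ L : ℝ, L₀ ≤ L → ∀ t : ℝ, T₀ ≤ t →
      ‖conreyV φ L ((((m : ℝ) + 1 / 2 : ℝ) : ℂ) + t * I) - (φ.coeff 0 : ℂ)‖ ≤
        (1 / ((m : ℝ) - 1 / 2) + η) * |φ.coeff 0| := by
  have hπ := Real.pi_pos
  have hπ3 := Real.pi_gt_three
  have hm' : (2 : ℝ) ≤ m := by exact_mod_cast hm
  set c : ℝ := φ.coeff 0 with hc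
  have hc0 : 0 < |c| := abs_pos.2 hφ
  set A₁ : ℝ := ∑ k ∈ φ.support.erase 0, |φ.coeff k| * (k.factorial : ℝ) with hA₁
  set ψ : ℝ[X] := φ.comp (1 - X) with hψ
  set A₂ : ℝ := ∑ k ∈ ψ.support, |ψ.coeff k| * (k.factorial : ℝ) with hA₂
  have hA₁0 : 0 ≤ A₁ := Finset.sum_nonneg fun k _ ↦ by positivity
  have hA₂0 : 0 ≤ A₂ := Finset.sum_nonneg fun k _ ↦ by positivity
  set M₁ : ℝ := 2 + 5 * (4 : ℝ) ^ ((m : ℝ) + 3 / 2) with hM₁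
  have hM₁0 : 0 < M₁ := by positivity
  set L₀ : ℝ := max 1 (2 * M₁ * A₁ / (η * |c|)) with hL₀
  set K₁ : ℝ := |c| * (5 * (4 : ℝ) ^ ((m : ℝ) + 1 / 2)) with hK₁
  set K₂ : ℝ := 2 * A₂ * (6 * (4 : ℝ) ^ ((m : ℝ) + 1 / 2)) * (2 : ℝ) ^ ((m : ℝ) + 3 / 2) with hK₂
  have hexp : 0 < (m : ℝ) - 3 / 2 := by linarith
  have hx₀t : Tendsto (fun t : ℝ ↦ Real.sqrt (t / (2 * π))) atTop atTop :=
    Real.tendsto_sqrt_atTop.comp (tendsto_id.atTop_div_const (by positivity))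
  have hlim : Tendsto (fun x : ℝ ↦ K₁ * x ^ (-(3 / 2 : ℝ)) + K₂ * x ^ (-((m : ℝ) - 3 / 2))) atTop
      (𝓝 0) := by
    have h1 := (tendsto_rpow_neg_atTop (by norm_num : (0 : ℝ) < 3 / 2)).const_mul K₁
    have h2 := (tendsto_rpow_neg_atTop hexp).const_mul K₂
    simpa using h1.add h2
  have hev : ∀ᶠ t : ℝ in atTop,
      K₁ * Real.sqrt (t / (2 * π)) ^ (-(3 / 2 : ℝ)) +
        K₂ * Real.sqrt (t / (2 * π)) ^ (-((m : ℝ) - 3 / 2)) < η * |c| / 2 :=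
    (hlim.comp hx₀t).eventually_lt_const (by positivity)
  obtain ⟨T₀, hT₀⟩ := Filter.eventually_atTop.1
    (hev.and (Filter.eventually_ge_atTop (2 * π * (4 * m + 6) ^ 2 + 128 * π + 1)))
  have hsq : 0 ≤ 2 * π * (4 * (m : ℝ) + 6) ^ 2 := by positivity
  have hT₀pos : 0 < T₀ := by
    have := (hT₀ T₀ le_rfl).2; nlinarith
  refine ⟨L₀, T₀, le_max_left _ _, hT₀pos, fun L hL t ht ↦ ?_⟩
  obtain ⟨hsmall, htm⟩ := hT₀ t ht
  have hL1 : 1 ≤ L := le_trans (le_max_left _ _) hL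
  have hL0 : 0 < L := by linarith
  have ht1 : 1 ≤ t := by nlinarith
  set s : ℂ := (((m : ℝ) + 1 / 2 : ℝ) : ℂ) + t * I with hs
  set x₀ : ℝ := Real.sqrt (t / (2 * π)) with hx₀
  have hX := le_sqrt_div_two_pi (by positivity : (0 : ℝ) ≤ 4 * m + 6) (y := t) (by linarith)
  have hx₀1 : 1 ≤ x₀ := by linarith
  have hx₀0 : 0 < x₀ := by linarith
  have hP := norm_polyDerivOp_riemannAux_sub_le_halfInteger φ hm hL1 htm
  have hD := norm_rsChi_mul_polyDerivOp_riemannAuxConj_le_halfInteger φ hm hL1 htm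
  -- `M₁ A₁ / L ≤ η |c| / 2`
  have hηc : 0 < η * |c| := by positivity
  have hLterm : M₁ * A₁ / L ≤ η * |c| / 2 := by
    have h2 : 2 * M₁ * A₁ / (η * |c|) ≤ L := le_trans (le_max_right _ _) hL
    rw [div_le_iff₀ hηc] at h2
    rw [div_le_div_iff₀ hL0 (by norm_num : (0 : ℝ) < 2)]
    calc M₁ * A₁ * 2 = 2 * M₁ * A₁ := by ring
      _ ≤ L * (η * |c|) := h2
      _ = η * |c| * L := mul_comm _ _
  -- the reflected term is `≤ K₂ x₀^{-(m - 3/2)}`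
  have htx : t = 2 * π * x₀ ^ 2 := by
    have e : 2 * π * (t / (2 * π)) = t := by field_simp
    rw [hx₀, Real.sq_sqrt (by positivity), e]
  have hDterm : 2 * (2 * π) ^ m / t ^ m * A₂ *
      (6 * (4 : ℝ) ^ ((m : ℝ) + 1 / 2) * (x₀ + 1) ^ ((m : ℝ) + 3 / 2)) ≤
        K₂ * x₀ ^ (-((m : ℝ) - 3 / 2)) := by
    have h1 : (x₀ + 1) ^ ((m : ℝ) + 3 / 2) ≤ (2 : ℝ) ^ ((m : ℝ) + 3 / 2) * x₀ ^ ((m : ℝ) + 3 / 2) := by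
      rw [← Real.mul_rpow (by norm_num) hx₀0.le]
      exact Real.rpow_le_rpow (by linarith) (by linarith) (by positivity)
    have h2 : t ^ m = (2 * π) ^ m * x₀ ^ ((2 * m : ℕ) : ℝ) := by
      rw [Real.rpow_natCast, htx, mul_pow, pow_mul]
    have h2π : (0 : ℝ) < (2 * π) ^ m := by positivity
    have h3 : x₀ ^ ((m : ℝ) + 3 / 2) / x₀ ^ ((2 * m : ℕ) : ℝ) = x₀ ^ (-((m : ℝ) - 3 / 2)) := by
      rw [← Real.rpow_sub hx₀0]; congr 1; push_cast; ring
    have h0 : 0 ≤ 2 * A₂ * (6 * (4 : ℝ) ^ ((m : ℝ) + 1 / 2)) := by positivity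
    calc 2 * (2 * π) ^ m / t ^ m * A₂ * (6 * (4 : ℝ) ^ ((m : ℝ) + 1 / 2) * (x₀ + 1) ^ ((m : ℝ) + 3 / 2))
        = 2 * A₂ * (6 * (4 : ℝ) ^ ((m : ℝ) + 1 / 2)) *
            ((x₀ + 1) ^ ((m : ℝ) + 3 / 2) * ((2 * π) ^ m / t ^ m)) := by ring
      _ ≤ 2 * A₂ * (6 * (4 : ℝ) ^ ((m : ℝ) + 1 / 2)) *
            (((2 : ℝ) ^ ((m : ℝ) + 3 / 2) * x₀ ^ ((m : ℝ) + 3 / 2)) * ((2 * π) ^ m / t ^ m)) := by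
          gcongr
      _ = K₂ * (x₀ ^ ((m : ℝ) + 3 / 2) / x₀ ^ ((2 * m : ℕ) : ℝ)) := by
          rw [h2, hK₂]; field_simp
      _ = K₂ * x₀ ^ (-((m : ℝ) - 3 / 2)) := by rw [h3]
  -- assemble
  have hV : conreyV φ L s - (c : ℂ) =
      (polyDerivOp φ (-L⁻¹) riemannAux s - (c : ℂ)) +
        rsChi s * polyDerivOp ψ L⁻¹ riemannAuxConj s := by
    rw [conreyV]; ring
  rw [hV]
  refine (norm_add_le _ _).trans ?_
  have hmc : 0 ≤ 1 / ((m : ℝ) - 1 / 2) := by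
    have : 0 < (m : ℝ) - 1 / 2 := by linarith
    positivity
  calc ‖polyDerivOp φ (-L⁻¹) riemannAux s - (c : ℂ)‖ + ‖rsChi s * polyDerivOp ψ L⁻¹ riemannAuxConj s‖
      ≤ (|c| * (1 / ((m : ℝ) - 1 / 2) + 5 * (4 : ℝ) ^ ((m : ℝ) + 1 / 2) * x₀ ^ (-(3 / 2 : ℝ))) +
            M₁ * A₁ / L) + K₂ * x₀ ^ (-((m : ℝ) - 3 / 2)) := add_le_add hP (hD.trans hDterm)
    _ = 1 / ((m : ℝ) - 1 / 2) * |c| + M₁ * A₁ / L +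
          (K₁ * x₀ ^ (-(3 / 2 : ℝ)) + K₂ * x₀ ^ (-((m : ℝ) - 3 / 2))) := by rw [hK₁]; ring
    _ ≤ 1 / ((m : ℝ) - 1 / 2) * |c| + η * |c| / 2 + η * |c| / 2 := by linarith
    _ = (1 / ((m : ℝ) - 1 / 2) + η) * |c| := by ring

end Literature.NumberTheory.LFunctions

end
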